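import Summits.ValiantsHypothesis.ValiantsHypothesis.Theorems.DivisionGapPerDivisionHardStubBlockArsenalAux
import Summits.ValiantsHypothesis.ValiantsHypothesis.Theorems.DivisionGapDefs

/-!
# Crux `DivisionGap.PerDivisionHard` (stmt-ValiantsHypothesis-5065), line `pair-descent-jss-endpoint` —
stub `stub_blockArsenal`: the placed block face is harder than the JSS bound

`stub_blockArsenal`: for all `c κ` there are `d n₁` such that for `n ≥ n₁`, every placement
`eR eC : BlockV b k m ≃ Fin n` of the block arsenal `G(b,k) ⊕ M₀` with `b ≥ (log₂ n + d)^d`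
has `((n+2)(2^{(log₂ n + c)^c} + 3))^κ < L_{ℝ≥0}(facePer (placedBlock eR eC))`.

## Phase structure of the perfect matchings of `G(b,k) ⊕ M₀`

`G(b,k) ⊕ M₀` (`BlockV`, `blockAdj`) is `K_{b,b}` with every core edge `(i, j)` subdivided into
the path  row `i` — col `(i,j,0)` — row `(i,j,0)` — col `(i,j,1)` — … — row `(i,j,k-1)` — col `j`
(`2k` internal vertices), padded by a perfect matching on `m` further vertices.  A perfect
matching is recorded as a bijection `g` from row labels to column labels all of whose pairs are
edges (`∀ r, blockAdj b k m r (g r) = true`); its PHASE MAP `phaseMap g : Fin b → Fin b` sends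
core row `i` to the index `j` of the path `(i, j)` it is matched into (for `k = 0`: of the core
column it is matched to).

* `path_of_adj` — once core row `i` enters the path `(i, j)`, the path is traversed in its "used"
  phase: row `(i,j,t)` ↦ col `(i,j,t+1)`, the last internal row ↦ core column `j`;
* `phaseMap_injective_of_adj` — hence the phase map is a permutation of `Fin b`;
* `canonMatch ρ`, `exists_adj_phaseMap_eq` — every permutation `ρ` is the phase map of the
  matching using exactly the paths `(i, ρ i)`.

## The projection

`blockSubst eR eC` sends the variable of a cell whose ROW label is the core row `i` to `X (i, j)`,
`j` the core-column index carried by its column label (`phaseIdx`), and every other variable to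
`1`; it is a projection (`isProjection_blockSubst`).  A permutation `σ` inside the placed face is
a perfect matching (`rowMatching`), and its monomial is sent to `∏_i X (i, phaseMap g i)`
(`aeval_blockSubst_monomial`); by the phase structure these are permutation patterns and all of
them occur, so the image of `facePer` has the support of `per_b` (`support_sum_prod_X_eq_perPoly`
of part Aux), and part Aux's `complexity_gt_of_perSupport_projection` (projections are free,
Jerrum–Snir by support, arithmetic with `d = c + 3κ + 7`, `n₁ = 0`) concludes.
-/

noncomputable section

-- `Summit.ValiantsHypothesis.ValiantsHypothesis.…` is the tree's mandated single-conjunct layout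
-- (Sub = Summit), so the duplicated namespace component is intended.
set_option linter.dupNamespace false

namespace Summit.ValiantsHypothesis.ValiantsHypothesis.Theorems.DivisionGapPerDivisionHard

open MvPolynomial Literature.Computability.AlgebraicComplexity
open scoped NNReal

variable {b k m : ℕ}

/-! ### Row matchings and their phase maps -/

/-- The core-column index carried by a label: `j` for the core column `j` and for an internal
vertex `(i, j, t)`; the junk value `dflt` on padding. [folklore] -/
def phaseIdx (dflt : Fin b) : BlockV b k m → Fin b
  | Sum.inl j => j
  | Sum.inr (Sum.inl p) => p.2.1
  | Sum.inr (Sum.inr _) => dflt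

/-- The phase map of a matching: core row `i` ↦ the index `j` of the path `(i, j)` (or, for
`k = 0`, of the core column) it is matched into. [folklore] -/
def phaseMap (g : BlockV b k m ≃ BlockV b k m) (i : Fin b) : Fin b :=
  phaseIdx i (g (Sum.inl i))

section RowMatching

/-! A perfect matching of `G(b,k) ⊕ M₀` is recorded as a bijection `g` from row labels to column
labels all of whose pairs are edges: `hg : ∀ r, blockAdj b k m r (g r) = true`. -/

variable {g : BlockV b k m ≃ BlockV b k m}

/-- Where a core row goes: to the core column `phaseMap g i` if `k = 0`, and to the first internal
column `(i, phaseMap g i, 0)` of its path otherwise. [folklore] -/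
theorem core_row_of_adj (hg : ∀ r, blockAdj b k m r (g r) = true) (i : Fin b) :
    (k = 0 ∧ g (Sum.inl i) = Sum.inl (phaseMap g i)) ∨
      ∃ hk : 0 < k, g (Sum.inl i) = Sum.inr (Sum.inl (i, phaseMap g i, ⟨0, hk⟩)) := by
  have h := hg (Sum.inl i)
  unfold phaseMap
  generalize g (Sum.inl i) = ℓ at h ⊢
  rcases ℓ with j | ⟨i', j', t'⟩ | u
  · left
    exact ⟨by simpa [blockAdj] using h, rfl⟩
  · right
    simp only [blockAdj, decide_eq_true_eq] at h
    obtain ⟨rfl, ht⟩ := h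
    refine ⟨by omega, ?_⟩
    simp only [phaseIdx, Sum.inr.injEq, Sum.inl.injEq, Prod.mk.injEq, true_and]
    exact Fin.ext ht
  · simp [blockAdj] at h

/-- One step along a used path: if column `(i, j, t)` is already taken by a row `r` other than
row `(i, j, t)`, then row `(i, j, t)` goes to column `(i, j, t+1)` (or to the core column `j` when
`t = k - 1`). [folklore] -/
theorem path_step_of_adj (hg : ∀ r, blockAdj b k m r (g r) = true) {i j : Fin b} {t : ℕ} (ht : t < k) {r : BlockV b k m}
    (hr : r ≠ Sum.inr (Sum.inl (i, j, ⟨t, ht⟩)))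
    (hprev : g r = Sum.inr (Sum.inl (i, j, ⟨t, ht⟩))) :
    g (Sum.inr (Sum.inl (i, j, ⟨t, ht⟩))) =
      if h' : t + 1 < k then Sum.inr (Sum.inl (i, j, ⟨t + 1, h'⟩)) else Sum.inl j := by
  have h := hg (Sum.inr (Sum.inl (i, j, ⟨t, ht⟩)))
  generalize hℓ : g (Sum.inr (Sum.inl (i, j, ⟨t, ht⟩))) = ℓ at h
  rcases ℓ with j' | ⟨i', j', t'⟩ | u
  · simp only [blockAdj, decide_eq_true_eq] at h
    obtain ⟨rfl, hk⟩ := h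
    rw [dif_neg (by omega)]
  · simp only [blockAdj, decide_eq_true_eq] at h
    obtain ⟨rfl, rfl, ht' | ht'⟩ := h
    · -- `g` would send both `r` and row `(i,j,t)` to column `(i,j,t)`
      exfalso
      have ht'' : t' = ⟨t, ht⟩ := Fin.ext ht'
      subst ht''
      exact hr (g.injective (hprev.trans hℓ.symm))
    · have hlt : t + 1 < k := ht' ▸ t'.2
      rw [dif_pos hlt]
      simp only [Sum.inr.injEq, Sum.inl.injEq, Prod.mk.injEq, true_and]
      exact Fin.ext ht'
  · simp [blockAdj] at h

/-- **The used phase of a path.**  If core row `i` is matched into the path `(i, j)`, then every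
internal row `(i, j, t)` is matched to the next internal column `(i, j, t+1)`, the last one to the
core column `j`. [folklore] -/
theorem path_of_adj (hg : ∀ r, blockAdj b k m r (g r) = true) {i j : Fin b} {hk : 0 < k}
    (h0 : g (Sum.inl i) = Sum.inr (Sum.inl (i, j, ⟨0, hk⟩))) (t : ℕ) (ht : t < k) :
    g (Sum.inr (Sum.inl (i, j, ⟨t, ht⟩))) =
      if h' : t + 1 < k then Sum.inr (Sum.inl (i, j, ⟨t + 1, h'⟩)) else Sum.inl j := by
  induction t with
  | zero => exact path_step_of_adj hg ht (by simp) h0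
  | succ t ih =>
    have hprev := ih (by omega)
    rw [dif_pos ht] at hprev
    exact path_step_of_adj hg ht (by simp) hprev

/-- The end of a used path: core row `i` matched into the path `(i, j)` forces the last internal
row `(i, j, k-1)` onto the core column `j`. [folklore] -/
theorem path_end_of_adj (hg : ∀ r, blockAdj b k m r (g r) = true) {i j : Fin b} {hk : 0 < k}
    (h0 : g (Sum.inl i) = Sum.inr (Sum.inl (i, j, ⟨0, hk⟩))) :
    g (Sum.inr (Sum.inl (i, j, ⟨k - 1, by omega⟩))) = Sum.inl j := by
  have := path_of_adj hg h0 (k - 1) (by omega)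
  rwa [dif_neg (by omega)] at this

/-- **The phase map of a perfect matching of `G(b,k) ⊕ M₀` is injective** (two core rows using
paths towards the same core column `j` would both need their last internal row matched to `j`).
[folklore] -/
theorem phaseMap_injective_of_adj (hg : ∀ r, blockAdj b k m r (g r) = true) :
    Function.Injective (phaseMap g) := by
  intro i₁ i₂ h
  rcases core_row_of_adj hg i₁ with ⟨hk, h₁⟩ | ⟨hk, h₁⟩
  · rcases core_row_of_adj hg i₂ with ⟨-, h₂⟩ | ⟨hk', -⟩
    · rw [h] at h₁
      exact Sum.inl_injective (g.injective (h₁.trans h₂.symm))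
    · omega
  · rcases core_row_of_adj hg i₂ with ⟨hk', -⟩ | ⟨hk', h₂⟩
    · omega
    · have e₁ := path_end_of_adj hg h₁
      have e₂ := path_end_of_adj hg h₂
      rw [h] at e₁
      have := g.injective (e₁.trans e₂.symm)
      simp only [Sum.inr.injEq, Sum.inl.injEq, Prod.mk.injEq] at this
      exact this.1

/-- Hence the phase map is a bijection of `Fin b`. [folklore] -/
theorem phaseMap_bijective_of_adj (hg : ∀ r, blockAdj b k m r (g r) = true) :
    Function.Bijective (phaseMap g) :=
  (phaseMap_injective_of_adj hg).bijective_of_finite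

end RowMatching

/-! ### Every permutation is a phase map -/

/-- The canonical matching with phase map `ρ` (rows ↦ columns): core row `i` ↦ column
`(i, ρ i, 0)` (core column `ρ i` if `k = 0`); on the used paths `(i, ρ i)` internal row
`(i, j, t)` ↦ column `(i, j, t+1)` resp. the core column `j` for `t = k-1`; on unused paths
internal row `(i, j, t)` ↦ column `(i, j, t)`; padding row `u` ↦ padding column `u`. [folklore] -/
def canonMatch (ρ : Equiv.Perm (Fin b)) : BlockV b k m → BlockV b k m
  | Sum.inl i => if hk : 0 < k then Sum.inr (Sum.inl (i, ρ i, ⟨0, hk⟩)) else Sum.inl (ρ i)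
  | Sum.inr (Sum.inl (i, j, t)) =>
      if j = ρ i then
        (if ht : (t : ℕ) + 1 < k then Sum.inr (Sum.inl (i, j, ⟨t + 1, ht⟩)) else Sum.inl j)
      else Sum.inr (Sum.inl (i, j, t))
  | Sum.inr (Sum.inr u) => Sum.inr (Sum.inr u)

/-- Its inverse (columns ↦ rows). [folklore] -/
def canonMatchInv (ρ : Equiv.Perm (Fin b)) : BlockV b k m → BlockV b k m
  | Sum.inl j =>
      if hk : 0 < k then Sum.inr (Sum.inl (ρ.symm j, j, ⟨k - 1, by omega⟩)) else Sum.inl (ρ.symm j)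
  | Sum.inr (Sum.inl (i, j, t)) =>
      if j = ρ i then
        (if ht : (t : ℕ) = 0 then Sum.inl i else Sum.inr (Sum.inl (i, j, ⟨t - 1, by omega⟩)))
      else Sum.inr (Sum.inl (i, j, t))
  | Sum.inr (Sum.inr u) => Sum.inr (Sum.inr u)

/-- `canonMatchInv ρ` is a left inverse of `canonMatch ρ`. [folklore] -/
theorem canonMatchInv_canonMatch (ρ : Equiv.Perm (Fin b)) (r : BlockV b k m) :
    canonMatchInv ρ (canonMatch ρ r) = r := by
  rcases r with i | ⟨i, j, t⟩ | u
  · by_cases hk : 0 < k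
    · simp [canonMatch, canonMatchInv, hk]
    · simp [canonMatch, canonMatchInv, hk]
  · by_cases hj : j = ρ i
    · by_cases ht : (t : ℕ) + 1 < k
      · simp only [canonMatch, hj, if_true, ht, dif_pos, canonMatchInv]
        simp
      · have hk : 0 < k := by omega
        have htk : (t : ℕ) = k - 1 := by omega
        subst hj
        simp only [canonMatch, if_true, ht, dif_neg, not_false_eq_true, canonMatchInv, hk, dif_pos,
          Equiv.symm_apply_apply, Sum.inr.injEq, Sum.inl.injEq, Prod.mk.injEq, true_and]
        exact Fin.ext htk.symm
    · simp [canonMatch, canonMatchInv, hj]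
  · simp [canonMatch, canonMatchInv]

/-- `canonMatch ρ` is a bijection. [folklore] -/
theorem canonMatch_bijective (ρ : Equiv.Perm (Fin b)) :
    Function.Bijective (canonMatch (k := k) (m := m) ρ) :=
  (Function.LeftInverse.injective (canonMatchInv_canonMatch ρ)).bijective_of_finite

/-- `canonMatch ρ` is a perfect matching of `G(b,k) ⊕ M₀`. [folklore] -/
theorem blockAdj_canonMatch (ρ : Equiv.Perm (Fin b)) (r : BlockV b k m) :
    blockAdj b k m r (canonMatch ρ r) = true := by
  rcases r with i | ⟨i, j, t⟩ | u
  · by_cases hk : 0 < k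
    · simp [canonMatch, hk, blockAdj]
    · simp only [canonMatch, hk, dif_neg, not_false_eq_true, blockAdj, decide_eq_true_eq]
      omega
  · by_cases hj : j = ρ i
    · by_cases ht : (t : ℕ) + 1 < k
      · simp [canonMatch, hj, ht, blockAdj]
      · simp only [canonMatch, hj, if_true, ht, dif_neg, not_false_eq_true, blockAdj,
          decide_eq_true_eq, true_and]
        omega
    · simp [canonMatch, hj, blockAdj]
  · simp [canonMatch, blockAdj]

/-- **Every permutation of `Fin b` is the phase map of a perfect matching of `G(b,k) ⊕ M₀`.**
[folklore] -/
theorem exists_adj_phaseMap_eq :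
    ∀ (b k m : ℕ) (ρ : Equiv.Perm (Fin b)), ∃ g : BlockV b k m ≃ BlockV b k m,
      (∀ r, blockAdj b k m r (g r) = true) ∧ phaseMap g = ρ := by
  intro b k m ρ
  refine ⟨Equiv.ofBijective _ (canonMatch_bijective ρ), fun r => blockAdj_canonMatch ρ r, ?_⟩
  funext i
  simp only [phaseMap, Equiv.ofBijective_apply, canonMatch]
  by_cases hk : 0 < k
  · simp [hk, phaseIdx]
  · simp [hk, phaseIdx]


variable {n : ℕ}

/-! ### The projection -/

/-- The substitution on labels: the cell (core row `i`, column `ℓ`) ↦ `X (i, phaseIdx i ℓ)`;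
cells in internal or padding rows ↦ `1`. [folklore] -/
def labelSubst (r ℓ : BlockV b k m) : MvPolynomial (Fin b × Fin b) ℝ≥0 :=
  match r with
  | Sum.inl i => X (i, phaseIdx i ℓ)
  | Sum.inr _ => 1

/-- The substitution on the cells of the placed matrix. [folklore] -/
def blockSubst (eR eC : BlockV b k m ≃ Fin n) (e : Fin n × Fin n) :
    MvPolynomial (Fin b × Fin b) ℝ≥0 :=
  labelSubst (eR.symm e.1) (eC.symm e.2)

/-- `blockSubst` is a projection (every variable ↦ a variable or `1`). [folklore] -/
theorem isProjection_blockSubst (eR eC : BlockV b k m ≃ Fin n)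
    (p : MvPolynomial (Fin n × Fin n) ℝ≥0) : IsProjection (aeval (blockSubst eR eC) p) p := by
  refine ⟨blockSubst eR eC, fun e => ?_, rfl⟩
  unfold blockSubst
  rcases eR.symm e.1 with i | y
  · left
    exact ⟨(i, phaseIdx i (eC.symm e.2)), rfl⟩
  · right
    exact ⟨1, by simp [labelSubst]⟩

/-! ### Permutations inside the placed face are row matchings -/

/-- The row matching of a permutation `σ` of `Fin n` (column `x` ↦ row `σ x`) read through the
placement: row label `r` ↦ the label of the column matched to it. [folklore] -/
def rowMatching (eR eC : BlockV b k m ≃ Fin n) (σ : Equiv.Perm (Fin n)) :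
    BlockV b k m ≃ BlockV b k m :=
  eR.trans (σ.symm.trans eC.symm)

/-- A permutation inside the placed face gives a perfect matching of `G(b,k) ⊕ M₀`. [folklore] -/
theorem adj_rowMatching {eR eC : BlockV b k m ≃ Fin n} {σ : Equiv.Perm (Fin n)}
    (hσ : ∀ x, (σ x, x) ∈ placedBlock eR eC) (r : BlockV b k m) :
    blockAdj b k m r (rowMatching eR eC σ r) = true := by
  have := hσ (σ.symm (eR r))
  simpa [placedBlock, rowMatching] using this

/-- The image of a placed permutation monomial: `∏_i X (i, phaseMap g i)` for its row matching
`g`. [folklore] -/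
theorem aeval_blockSubst_monomial (eR eC : BlockV b k m ≃ Fin n) (σ : Equiv.Perm (Fin n)) :
    aeval (blockSubst eR eC) (monomial (permMonomial σ) (1 : ℝ≥0)) =
      ∏ i : Fin b, (X (i, phaseMap (rowMatching eR eC σ) i) : MvPolynomial _ ℝ≥0) := by
  rw [show (monomial (permMonomial σ) (1 : ℝ≥0) : MvPolynomial _ ℝ≥0) = ∏ x, X (σ x, x) by
    rw [permMonomial, monomial_sum_one]; rfl]
  rw [map_prod]
  simp only [aeval_X]
  rw [← Fintype.prod_equiv (eR.trans σ.symm)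
    (fun r => labelSubst r (rowMatching eR eC σ r)) (fun x => blockSubst eR eC (σ x, x))
    (fun r => by simp [blockSubst, rowMatching])]
  rw [Fintype.prod_sum_type]
  have h1 : ∏ y : (Fin b × Fin b × Fin k) ⊕ Fin m,
      labelSubst (Sum.inr y) (rowMatching eR eC σ (Sum.inr y)) = 1 :=
    Finset.prod_eq_one fun _ _ => rfl
  rw [h1, mul_one]
  rfl

/-- The image of the placed face permanent. [folklore] -/
theorem aeval_blockSubst_facePer (eR eC : BlockV b k m ≃ Fin n) :
    aeval (blockSubst eR eC) (facePer (placedBlock eR eC)) =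
      ∑ σ ∈ (Finset.univ : Finset (Equiv.Perm (Fin n))).filter
          (fun σ => ∀ i, (σ i, i) ∈ placedBlock eR eC),
        ∏ i : Fin b, (X (i, phaseMap (rowMatching eR eC σ) i) : MvPolynomial _ ℝ≥0) := by
  rw [facePer, map_sum]
  exact Finset.sum_congr rfl fun σ _ => aeval_blockSubst_monomial eR eC σ

/-- **The image of the placed face permanent has the support of `per_b`.** [folklore] -/
theorem support_aeval_blockSubst_facePer (eR eC : BlockV b k m ≃ Fin n) :
    (aeval (blockSubst eR eC) (facePer (placedBlock eR eC))).support =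
      (perPoly (Fin b) ℝ≥0).support := by
  rw [aeval_blockSubst_facePer]
  apply support_sum_prod_X_eq_perPoly
  · intro σ hσ
    simp only [Finset.mem_filter, Finset.mem_univ, true_and] at hσ
    exact phaseMap_bijective_of_adj (adj_rowMatching hσ)
  · intro ρ
    obtain ⟨g, hg, hρ⟩ := exists_adj_phaseMap_eq b k m ρ
    refine ⟨eC.symm.trans (g.symm.trans eR), ?_, ?_⟩
    · simp only [Finset.mem_filter, Finset.mem_univ, true_and]
      intro x
      simp only [placedBlock, Finset.mem_filter, Finset.mem_univ, true_and, Equiv.trans_apply,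
        Equiv.symm_apply_apply]
      have := hg (g.symm (eC.symm x))
      simpa using this
    · rw [← hρ]
      congr 1
      ext r
      simp [rowMatching]

/-! ### The stub -/

/-- **stub_blockArsenal (the unconditional arsenal of the line `pair-descent-jss-endpoint`).**
For all `c κ` there are `d n₁` (`d = c + 3κ + 7`, `n₁ = 0`) such that for `n ≥ n₁` and every
placement `eR eC` of `G(b,k) ⊕ M₀` with `b ≥ (log₂ n + d)^d`:
`((n+2)(2^{(log₂ n + c)^c} + 3))^κ < L_{ℝ≥0}(facePer (placedBlock eR eC))` — the placed face
projects (`blockSubst`, phase bijection) onto a polynomial with the support of `per_b`, which costs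
`≥ 2^{b/3}` (Jerrum–Snir by support), and `2^{b/3}` beats the bound. [folklore] -/
theorem stub_blockArsenal :
    ∀ c κ : ℕ, ∃ d n₁ : ℕ, ∀ n ≥ n₁, ∀ (b k m : ℕ) (eR eC : BlockV b k m ≃ Fin n),
      (Nat.log 2 n + d) ^ d ≤ b →
      ((n + 2) * (2 ^ ((Nat.log 2 n + c) ^ c) + 3)) ^ κ <
        complexity (facePer (placedBlock eR eC)) := by
  intro c κ
  obtain ⟨d, n₁, h⟩ := complexity_gt_of_perSupport_projection c κ
  exact ⟨d, n₁, fun n hn b k m eR eC hb => h n hn b hb _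
    ⟨_, isProjection_blockSubst eR eC _, support_aeval_blockSubst_facePer eR eC⟩⟩

end Summit.ValiantsHypothesis.ValiantsHypothesis.Theorems.DivisionGapPerDivisionHard

end
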